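import Summits.CriticalPhenomena.Ising3DConformalLimit.Theses.BallSpecification
import Literature.Probability.LatticeModels.MoebiusWeightedAction
import HarnessLib

/-!
# Stub `stub_transportDLR` of line `birth` (skeleton r2) for crux `BallSpecifiedInversionUpgrade` (stmt-CriticalPhenomena-11248)

Route `route-CriticalPhenomena-BallSpecification`, sub-problem `Ising3DConformalLimit`.  Target tree file:
`Summits/CriticalPhenomena/Ising3DConformalLimit/Theorems/BallSpecificationBallSpecifiedInversionUpgradeTransportDLR.lean`,
landed with `--supports stmt-CriticalPhenomena-11248` (the theorem name and statement below are the REGISTERED stub; do not change them).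

## Content (model-free measure theory: the punctured DLR equations of a transported law)

Let `Ω = FieldConfig E`, `E = ℝ³`, let `μ` be a law with ball kernels `γ'` (probability, exterior
measurable, `IsGibbsFor γ' μ univ`) which are (CB) locally inversion covariant, and let `Q` be a
continuous linear operator on test functions with (P3) `Q f = ι^*_Δ f` for `f` compactly supported in
an open region `R ∌ 0` and (P2) `x ∈ tsupport (Q f) → x ≠ 0 ∧ ι x ∈ tsupport f` (`ι` the unit
inversion).  Then the transported law `ν := map (act Q) μ` satisfies the DLR equation
`ν (A ∩ B) = ∫⁻_B γ' c r η A dν` for every closed ball `B̄(c, r) ⊆ R`, every interior event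
`A ∈ extEvents (ball c r)` and every exterior event `B ∈ extEvents (closedBall c r)ᶜ`.

Proof: pull `A`, `B` back along `T := act Q` to the `ι`-preimage ball `B̄(c₀, r₀)`,
`c₀ = c / (‖c‖² - r²)`, `r₀ = r / (‖c‖² - r²)` (`T⁻¹ B` is exterior there by (P2)), apply the DLR
equation of `μ` on that ball, identify `γ' c₀ r₀ η (T⁻¹ A) = γ' c r (T η) A` for `μ`-a.e. `η` from
(CB) at `η' := T η` by a π-λ argument over the cylinder events of test functions supported in
`ball c r` (`ext_on_measurableSpace_of_generate_finite`), and finish with `setLIntegral_map`.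

References: H.-O. Georgii, *Gibbs Measures and Phase Transitions* (2011), Def. 1.23 and
Remark 1.24 (DLR equations; image specifications under a transformation); M. Röckner,
Comm. Math. Phys. 106 (1986) §1.  Theorem-only file (no definitions).
-/

noncomputable section

namespace Summit.CriticalPhenomena.Ising3DConformalLimit.BallSpecificationBallSpecifiedInversionUpgrade

open MeasureTheory Metric Set
open Literature.Probability.LatticeModels Literature.MathematicalPhysics.QuantumLattice
open scoped SchwartzMap ENNReal

/-! ### Cylinder events and the σ-algebras `extEvents U` (general test-function space) -/

section General

variable {E : Type*} [NormedAddCommGroup E] [NormedSpace ℝ E]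

/-- The transpose `act T` of an operator `T` on test functions pulls the events seen in `U` back to
events seen in `V` as soon as `T` maps test functions supported in `U` to test functions supported
in `V`: `(extEvents U).comap (act T) ≤ extEvents V`. [folklore] -/
theorem transportDLR_comap_extEvents_le {T : 𝓢(E, ℝ) →L[ℝ] 𝓢(E, ℝ)} {U V : Set E}
    (h : ∀ f : 𝓢(E, ℝ), tsupport f ⊆ U → tsupport (T f) ⊆ V) :
    (extEvents U).comap (FieldConfig.act T) ≤ extEvents (E := E) V := by
  refine MeasurableSpace.comap_le_iff_le_map.2 (iSup₂_le fun f hf => ?_)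
  refine MeasurableSpace.comap_le_iff_le_map.1 ?_
  rw [MeasurableSpace.comap_comp]
  have hcomp : ((fun ω : FieldConfig E => ω f) ∘ FieldConfig.act T) =
      fun ω : FieldConfig E => ω (T f) := rfl
  rw [hcomp]
  exact le_iSup₂_of_le (f := fun (f : 𝓢(E, ℝ)) (_ : tsupport f ⊆ V) =>
    MeasurableSpace.comap (fun ω : FieldConfig E => ω f) (borel ℝ)) (T f) (h f hf) le_rfl

/-- The cylinder events `{ω | (ω (g k))_k ∈ D}` over finite families of test functions supported in
`U` form a π-system (concatenate the two families). [folklore] -/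
theorem transportDLR_isPiSystem_cyl (U : Set E) :
    IsPiSystem {S : Set (FieldConfig E) | ∃ (m : ℕ) (g : Fin m → 𝓢(E, ℝ)) (D : Set (Fin m → ℝ)),
      (∀ k, tsupport (g k) ⊆ U) ∧ MeasurableSet D ∧
        S = (fun (ω : FieldConfig E) (k : Fin m) => ω (g k)) ⁻¹' D} := by
  rintro _ ⟨m, g, D, hg, hD, rfl⟩ _ ⟨m', g', D', hg', hD', rfl⟩ _
  refine ⟨m + m', Fin.append g g',
    (fun (v : Fin (m + m') → ℝ) (i : Fin m) => v (Fin.castAdd m' i)) ⁻¹' D ∩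
      (fun (v : Fin (m + m') → ℝ) (j : Fin m') => v (Fin.natAdd m j)) ⁻¹' D', ?_, ?_, ?_⟩
  · intro k
    induction k using Fin.addCases with
    | left i => rw [Fin.append_left]; exact hg i
    | right j => rw [Fin.append_right]; exact hg' j
  · exact (hD.preimage (measurable_pi_lambda _ fun i => measurable_pi_apply _)).inter
      (hD'.preimage (measurable_pi_lambda _ fun j => measurable_pi_apply _))
  · ext ω
    simp only [mem_inter_iff, mem_preimage, Fin.append_left, Fin.append_right]

/-- `extEvents U` is generated by the cylinder events over finite families of test functions
supported in `U`. [folklore] -/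
theorem transportDLR_extEvents_eq_generateFrom (U : Set E) :
    extEvents (E := E) U = MeasurableSpace.generateFrom
      {S : Set (FieldConfig E) | ∃ (m : ℕ) (g : Fin m → 𝓢(E, ℝ)) (D : Set (Fin m → ℝ)),
        (∀ k, tsupport (g k) ⊆ U) ∧ MeasurableSet D ∧
          S = (fun (ω : FieldConfig E) (k : Fin m) => ω (g k)) ⁻¹' D} := by
  refine le_antisymm (iSup₂_le fun f hf => ?_) (MeasurableSpace.generateFrom_le ?_)
  · rintro S ⟨t, ht, rfl⟩
    refine MeasurableSpace.measurableSet_generateFrom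
      ⟨1, fun _ => f, (fun v : Fin 1 → ℝ => v 0) ⁻¹' t, fun _ => hf, ?_, rfl⟩
    borelize ℝ
    exact measurable_pi_apply (0 : Fin 1) ht
  · rintro S ⟨m, g, D, hg, hD, rfl⟩
    exact (@measurable_pi_lambda (FieldConfig E) (Fin m) (fun _ => ℝ) (extEvents U) _ _
      fun k => measurable_eval_of_tsupport_subset (hg k)) hD

/-- **Finite measures agreeing on cylinders agree on `extEvents U`.** If two finite measures on `Ω`
with the same total mass have the same finite-dimensional marginals `(ω (g k))_k` for all finite
families of test functions supported in `U`, they agree on every event of `extEvents U` (π-λ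
theorem). [folklore] -/
theorem transportDLR_measure_ext_extEvents {U : Set E} {ν₁ ν₂ : Measure (FieldConfig E)}
    [IsFiniteMeasure ν₁] (huniv : ν₁ univ = ν₂ univ)
    (h : ∀ (m : ℕ) (g : Fin m → 𝓢(E, ℝ)), (∀ k, tsupport (g k) ⊆ U) →
      ν₁.map (fun (ω : FieldConfig E) (k : Fin m) => ω (g k)) =
        ν₂.map (fun (ω : FieldConfig E) (k : Fin m) => ω (g k)))
    {A : Set (FieldConfig E)} (hA : MeasurableSet[extEvents U] A) : ν₁ A = ν₂ A := by
  refine ext_on_measurableSpace_of_generate_finite _ _ ?_ (extEvents_le U)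
    (transportDLR_extEvents_eq_generateFrom U) (transportDLR_isPiSystem_cyl U) huniv hA
  rintro S ⟨m, g, D, hg, hD, rfl⟩
  have hΦ : Measurable fun (ω : FieldConfig E) (k : Fin m) => ω (g k) :=
    measurable_pi_lambda _ fun k => measurable_eval (g k)
  rw [← Measure.map_apply hΦ hD, ← Measure.map_apply hΦ hD, h m g hg]

end General

/-! ### Ball geometry under the unit inversion in `ℝ³` -/

/-- The involution algebra of the inversion image of a ball, squared norms: for `k = ‖c‖² - r² > 0`,
`‖c/k‖² - (r/k)² = 1/k`. [folklore] -/
theorem transportDLR_normSq_sub_sq {c : EuclideanSpace ℝ (Fin 3)} {r : ℝ}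
    (hk : 0 < ‖c‖ ^ 2 - r ^ 2) :
    ‖(‖c‖ ^ 2 - r ^ 2)⁻¹ • c‖ ^ 2 - (r / (‖c‖ ^ 2 - r ^ 2)) ^ 2 = (‖c‖ ^ 2 - r ^ 2)⁻¹ := by
  have hk' : ‖c‖ ^ 2 - r ^ 2 ≠ 0 := hk.ne'
  rw [norm_smul, Real.norm_eq_abs, abs_inv, abs_of_pos hk, mul_pow, div_pow, inv_pow]
  field_simp

/-- The inversion image of a ball is an involution on centres: with `c₀ = c/k`, `r₀ = r/k`,
`k = ‖c‖² - r² > 0`, one has `c = c₀ / (‖c₀‖² - r₀²)`. [folklore] -/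
theorem transportDLR_centre_invol {c : EuclideanSpace ℝ (Fin 3)} {r : ℝ}
    (hk : 0 < ‖c‖ ^ 2 - r ^ 2) :
    c = (‖(‖c‖ ^ 2 - r ^ 2)⁻¹ • c‖ ^ 2 - (r / (‖c‖ ^ 2 - r ^ 2)) ^ 2)⁻¹ •
      (‖c‖ ^ 2 - r ^ 2)⁻¹ • c := by
  rw [transportDLR_normSq_sub_sq hk, inv_inv, smul_smul, mul_inv_cancel₀ hk.ne', one_smul]

/-- The inversion image of a ball is an involution on radii: with `c₀ = c/k`, `r₀ = r/k`,
`k = ‖c‖² - r² > 0`, one has `r = r₀ / (‖c₀‖² - r₀²)`. [folklore] -/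
theorem transportDLR_radius_invol {c : EuclideanSpace ℝ (Fin 3)} {r : ℝ}
    (hk : 0 < ‖c‖ ^ 2 - r ^ 2) :
    r = r / (‖c‖ ^ 2 - r ^ 2) /
      (‖(‖c‖ ^ 2 - r ^ 2)⁻¹ • c‖ ^ 2 - (r / (‖c‖ ^ 2 - r ^ 2)) ^ 2) := by
  rw [transportDLR_normSq_sub_sq hk, div_inv_eq_mul, div_mul_cancel₀ _ hk.ne']

/-- Support transport under (P2): if every point of `tsupport (Q f)` is a non-zero point whose
inversion lies in `tsupport f`, then `Q` maps test functions supported off `B̄(c, r)` (`0 < r < ‖c‖`)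
to test functions supported off the inversion image `B̄(c/k, r/k)`, `k = ‖c‖² - r²`. [folklore] -/
theorem transportDLR_tsupport_subset_compl
    {Q : 𝓢(EuclideanSpace ℝ (Fin 3), ℝ) →L[ℝ] 𝓢(EuclideanSpace ℝ (Fin 3), ℝ)}
    (hQ2 : ∀ (f : 𝓢(EuclideanSpace ℝ (Fin 3), ℝ)) (x : EuclideanSpace ℝ (Fin 3)),
      x ∈ tsupport (Q f : EuclideanSpace ℝ (Fin 3) → ℝ) →
        x ≠ 0 ∧ EuclideanGeometry.inversion 0 1 x ∈ tsupport (f : EuclideanSpace ℝ (Fin 3) → ℝ))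
    {c : EuclideanSpace ℝ (Fin 3)} {r : ℝ} (hr : 0 < r) (hrc : r < ‖c‖)
    {f : 𝓢(EuclideanSpace ℝ (Fin 3), ℝ)} (hf : tsupport f ⊆ (closedBall c r)ᶜ) :
    tsupport (Q f) ⊆ (closedBall ((‖c‖ ^ 2 - r ^ 2)⁻¹ • c) (r / (‖c‖ ^ 2 - r ^ 2)))ᶜ := by
  intro x hx hxball
  obtain ⟨-, hιx⟩ := hQ2 f x hx
  rw [← image_inversion_closedBall hr hrc] at hxball
  obtain ⟨y, hy, rfl⟩ := hxball
  rw [EuclideanGeometry.inversion_inversion _ one_ne_zero] at hιx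
  exact hf hιx hy

/-- A closed ball inside an open set has a slightly larger open ball inside it (compactness of closed
balls in `ℝ³`). [folklore] -/
theorem transportDLR_exists_ball_subset {R : Set (EuclideanSpace ℝ (Fin 3))} (hR : IsOpen R)
    {c : EuclideanSpace ℝ (Fin 3)} {r : ℝ} (hr : 0 ≤ r) (hsub : closedBall c r ⊆ R) :
    ∃ ε : ℝ, 0 < ε ∧ ball c (r + ε) ⊆ R := by
  obtain ⟨δ, hδ, h⟩ := (isCompact_closedBall c r).exists_thickening_subset_open hR hsub
  refine ⟨δ, hδ, ?_⟩
  rw [add_comm, ← thickening_closedBall hδ hr c]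
  exact h

/-- A test function supported in an open ball of `ℝ³` has compact support. [folklore] -/
theorem transportDLR_hasCompactSupport {c : EuclideanSpace ℝ (Fin 3)} {r : ℝ}
    {f : 𝓢(EuclideanSpace ℝ (Fin 3), ℝ)} (hf : tsupport f ⊆ ball c r) :
    HasCompactSupport (f : EuclideanSpace ℝ (Fin 3) → ℝ) :=
  (isCompact_closedBall c r).of_isClosed_subset (isClosed_tsupport _)
    (hf.trans ball_subset_closedBall)

/-! ### The kernel identity and the transported DLR equation -/

/-- **Key a.e. identity.** Under (CB) for the pair (preimage ball `B̄(c₀, r₀)`, target ball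
`B̄(c, r) ⊆ R`) and (P3) on `R`, for `μ`-a.e. `η` the pulled-back kernel of the preimage ball and
the kernel of the target ball at the transported datum agree on interior events:
`γ' c₀ r₀ η ((act Q)⁻¹ A) = γ' c r (act Q η) A` for `A ∈ extEvents (ball c r)` (π-λ over cylinder
events; (CB) supplies equality of all finite-dimensional marginals). [folklore] -/
theorem transportDLR_kernel_ae (Δ : ℝ)
    {μ : Measure (FieldConfig (EuclideanSpace ℝ (Fin 3)))}
    {γ' : EuclideanSpace ℝ (Fin 3) → ℝ → FieldConfig (EuclideanSpace ℝ (Fin 3)) →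
      Measure (FieldConfig (EuclideanSpace ℝ (Fin 3)))}
    {Q : 𝓢(EuclideanSpace ℝ (Fin 3), ℝ) →L[ℝ] 𝓢(EuclideanSpace ℝ (Fin 3), ℝ)}
    {R : Set (EuclideanSpace ℝ (Fin 3))} (hRo : IsOpen R)
    (k1 : ∀ c r, 0 < r → ∀ η, IsProbabilityMeasure (γ' c r η))
    (hCB : ∀ (c : EuclideanSpace ℝ (Fin 3)) (r : ℝ), 0 < r → r < ‖c‖ →
      ∀ (c' : EuclideanSpace ℝ (Fin 3)) (r' : ℝ), c' = (‖c‖ ^ 2 - r ^ 2)⁻¹ • c →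
      r' = r / (‖c‖ ^ 2 - r ^ 2) → ∀ᵐ η ∂(μ),
      ∀ (η' : FieldConfig (EuclideanSpace ℝ (Fin 3))) (ε : ℝ), 0 < ε →
      (∀ f : 𝓢(EuclideanSpace ℝ (Fin 3), ℝ), HasCompactSupport (f : EuclideanSpace ℝ (Fin 3) → ℝ) →
        tsupport (f : EuclideanSpace ℝ (Fin 3) → ℝ) ⊆ ball c' (r' + ε) \ closedBall c' r' →
        η' f = η (moebiusWeightedAction ConformalChart.unitInversion Δ f)) →
      ∀ (m : ℕ) (g : Fin m → 𝓢(EuclideanSpace ℝ (Fin 3), ℝ)),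
      (∀ k, (HasCompactSupport (g k : EuclideanSpace ℝ (Fin 3) → ℝ) ∧
        tsupport (g k : EuclideanSpace ℝ (Fin 3) → ℝ) ⊆ ball c' r')) →
      Measure.map (fun ω : FieldConfig (EuclideanSpace ℝ (Fin 3)) => fun k : Fin m => ω (g k))
          (γ' c' r' η') =
        Measure.map (fun ω : FieldConfig (EuclideanSpace ℝ (Fin 3)) => fun k : Fin m =>
          ω (moebiusWeightedAction ConformalChart.unitInversion Δ (g k))) (γ' c r η))
    (hQ3 : ∀ f : 𝓢(EuclideanSpace ℝ (Fin 3), ℝ), HasCompactSupport (f : EuclideanSpace ℝ (Fin 3) → ℝ) →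
      tsupport (f : EuclideanSpace ℝ (Fin 3) → ℝ) ⊆ R →
      Q f = moebiusWeightedAction ConformalChart.unitInversion Δ f)
    {c : EuclideanSpace ℝ (Fin 3)} {r : ℝ} (hr : 0 < r) (hrc : r < ‖c‖) (hsub : closedBall c r ⊆ R)
    {A : Set (FieldConfig (EuclideanSpace ℝ (Fin 3)))} (hA : MeasurableSet[extEvents (ball c r)] A) :
    ∀ᵐ η ∂μ, γ' ((‖c‖ ^ 2 - r ^ 2)⁻¹ • c) (r / (‖c‖ ^ 2 - r ^ 2)) η (FieldConfig.act Q ⁻¹' A) =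
      γ' c r (FieldConfig.act Q η) A := by
  have hk : 0 < ‖c‖ ^ 2 - r ^ 2 := by nlinarith [norm_nonneg c]
  have hr₀ : 0 < r / (‖c‖ ^ 2 - r ^ 2) := div_pos hr hk
  obtain ⟨ε, hε, hballR⟩ := transportDLR_exists_ball_subset hRo hr.le hsub
  have hT : Measurable (FieldConfig.act Q) := FieldConfig.measurable_act Q
  have hA' : MeasurableSet A := extEvents_le _ _ hA
  filter_upwards [hCB _ _ hr₀ (lt_norm_center_inversion hr hrc) c r (transportDLR_centre_invol hk)
    (transportDLR_radius_invol hk)] with η hη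
  have H := hη (FieldConfig.act Q η) ε hε (fun f hfc hft => by
    rw [FieldConfig.act_apply, hQ3 f hfc (hft.trans (Set.sdiff_subset.trans hballR))])
  haveI := k1 c r hr (FieldConfig.act Q η)
  haveI := k1 ((‖c‖ ^ 2 - r ^ 2)⁻¹ • c) (r / (‖c‖ ^ 2 - r ^ 2)) hr₀ η
  haveI : IsProbabilityMeasure ((γ' ((‖c‖ ^ 2 - r ^ 2)⁻¹ • c) (r / (‖c‖ ^ 2 - r ^ 2)) η).map
      (FieldConfig.act Q)) := Measure.isProbabilityMeasure_map hT.aemeasurable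
  rw [← Measure.map_apply (μ := γ' _ _ η) hT hA']
  symm
  refine transportDLR_measure_ext_extEvents (by simp only [measure_univ]) (fun m g hg => ?_) hA
  have hΦ : Measurable fun (ω : FieldConfig (EuclideanSpace ℝ (Fin 3))) (k : Fin m) => ω (g k) :=
    measurable_pi_lambda _ fun k => measurable_eval (g k)
  rw [Measure.map_map hΦ hT]
  have hcomp : ((fun (ω : FieldConfig (EuclideanSpace ℝ (Fin 3))) (k : Fin m) => ω (g k)) ∘
      FieldConfig.act Q) = fun ω k => ω (moebiusWeightedAction ConformalChart.unitInversion Δ (g k)) := by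
    funext ω k
    rw [Function.comp_apply, FieldConfig.act_apply, hQ3 (g k) (transportDLR_hasCompactSupport (hg k))
      ((hg k).trans (ball_subset_closedBall.trans hsub))]
  rw [hcomp]
  exact H m g fun k => ⟨transportDLR_hasCompactSupport (hg k), hg k⟩

/-- **Transported DLR equation** (the content of the stub, with the operator `Q = P s` and the
region `R = R_s` abstracted): for `R` open with `0 ∉ R`, kernels `γ'` (probability, exterior
measurable, DLR for `μ` on all balls, (CB) locally inversion covariant) and `Q` with (P3) on `R` and
(P2), the law `map (act Q) μ` satisfies the DLR equation on every closed ball inside `R` for interior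
events `A` and exterior events `B`. [folklore] -/
theorem transportDLR_main (Δ : ℝ)
    {μ : Measure (FieldConfig (EuclideanSpace ℝ (Fin 3)))}
    {γ' : EuclideanSpace ℝ (Fin 3) → ℝ → FieldConfig (EuclideanSpace ℝ (Fin 3)) →
      Measure (FieldConfig (EuclideanSpace ℝ (Fin 3)))}
    {Q : 𝓢(EuclideanSpace ℝ (Fin 3), ℝ) →L[ℝ] 𝓢(EuclideanSpace ℝ (Fin 3), ℝ)}
    {R : Set (EuclideanSpace ℝ (Fin 3))} (hRo : IsOpen R) (hR0 : (0 : EuclideanSpace ℝ (Fin 3)) ∉ R)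
    (k1 : ∀ c r, 0 < r → ∀ η, IsProbabilityMeasure (γ' c r η))
    (k2 : ∀ c r, 0 < r → ∀ A, MeasurableSet A →
      Measurable[extEvents (closedBall c r)ᶜ] (fun η => γ' c r η A))
    (hG : IsGibbsFor γ' μ univ)
    (hCB : ∀ (c : EuclideanSpace ℝ (Fin 3)) (r : ℝ), 0 < r → r < ‖c‖ →
      ∀ (c' : EuclideanSpace ℝ (Fin 3)) (r' : ℝ), c' = (‖c‖ ^ 2 - r ^ 2)⁻¹ • c →
      r' = r / (‖c‖ ^ 2 - r ^ 2) → ∀ᵐ η ∂(μ),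
      ∀ (η' : FieldConfig (EuclideanSpace ℝ (Fin 3))) (ε : ℝ), 0 < ε →
      (∀ f : 𝓢(EuclideanSpace ℝ (Fin 3), ℝ), HasCompactSupport (f : EuclideanSpace ℝ (Fin 3) → ℝ) →
        tsupport (f : EuclideanSpace ℝ (Fin 3) → ℝ) ⊆ ball c' (r' + ε) \ closedBall c' r' →
        η' f = η (moebiusWeightedAction ConformalChart.unitInversion Δ f)) →
      ∀ (m : ℕ) (g : Fin m → 𝓢(EuclideanSpace ℝ (Fin 3), ℝ)),
      (∀ k, (HasCompactSupport (g k : EuclideanSpace ℝ (Fin 3) → ℝ) ∧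
        tsupport (g k : EuclideanSpace ℝ (Fin 3) → ℝ) ⊆ ball c' r')) →
      Measure.map (fun ω : FieldConfig (EuclideanSpace ℝ (Fin 3)) => fun k : Fin m => ω (g k))
          (γ' c' r' η') =
        Measure.map (fun ω : FieldConfig (EuclideanSpace ℝ (Fin 3)) => fun k : Fin m =>
          ω (moebiusWeightedAction ConformalChart.unitInversion Δ (g k))) (γ' c r η))
    (hQ3 : ∀ f : 𝓢(EuclideanSpace ℝ (Fin 3), ℝ), HasCompactSupport (f : EuclideanSpace ℝ (Fin 3) → ℝ) →
      tsupport (f : EuclideanSpace ℝ (Fin 3) → ℝ) ⊆ R →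
      Q f = moebiusWeightedAction ConformalChart.unitInversion Δ f)
    (hQ2 : ∀ (f : 𝓢(EuclideanSpace ℝ (Fin 3), ℝ)) (x : EuclideanSpace ℝ (Fin 3)),
      x ∈ tsupport (Q f : EuclideanSpace ℝ (Fin 3) → ℝ) →
        x ≠ 0 ∧ EuclideanGeometry.inversion 0 1 x ∈ tsupport (f : EuclideanSpace ℝ (Fin 3) → ℝ))
    {c : EuclideanSpace ℝ (Fin 3)} {r : ℝ} (hr : 0 < r) (hsub : closedBall c r ⊆ R)
    {A : Set (FieldConfig (EuclideanSpace ℝ (Fin 3)))} (hA : MeasurableSet[extEvents (ball c r)] A)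
    {B : Set (FieldConfig (EuclideanSpace ℝ (Fin 3)))}
    (hB : MeasurableSet[extEvents (closedBall c r)ᶜ] B) :
    (μ.map (FieldConfig.act Q)) (A ∩ B) = ∫⁻ η in B, γ' c r η A ∂(μ.map (FieldConfig.act Q)) := by
  have hrc : r < ‖c‖ := by
    by_contra h
    exact hR0 (hsub (by rw [mem_closedBall, dist_zero_left]; exact not_lt.1 h))
  have hk : 0 < ‖c‖ ^ 2 - r ^ 2 := by nlinarith [norm_nonneg c]
  have hr₀ : 0 < r / (‖c‖ ^ 2 - r ^ 2) := div_pos hr hk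
  have hT : Measurable (FieldConfig.act Q) := FieldConfig.measurable_act Q
  have hA' : MeasurableSet A := extEvents_le _ _ hA
  have hB' : MeasurableSet B := extEvents_le _ _ hB
  have hTB : MeasurableSet[extEvents
      (closedBall ((‖c‖ ^ 2 - r ^ 2)⁻¹ • c) (r / (‖c‖ ^ 2 - r ^ 2)))ᶜ] (FieldConfig.act Q ⁻¹' B) :=
    transportDLR_comap_extEvents_le
      (fun f hf => transportDLR_tsupport_subset_compl hQ2 hr hrc hf) _ ⟨B, hB, rfl⟩
  have hγm : Measurable fun η => γ' c r η A := (k2 c r hr A hA').mono (extEvents_le _) le_rfl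
  rw [Measure.map_apply hT (hA'.inter hB'), preimage_inter,
    hG.2 _ _ hr₀ (subset_univ _) _ (hT hA') _ hTB, setLIntegral_map hB' hγm hT]
  exact lintegral_congr_ae (ae_restrict_of_ae
    (transportDLR_kernel_ae Δ hRo k1 hCB hQ3 hr hrc hsub hA))

/-- Registered stub `stub_transportDLR` of crux `BallSpecifiedInversionUpgrade` (stmt-CriticalPhenomena-11248), line `birth` r2. -/
theorem stub_transportDLR :
    ∀ (Δ : ℝ) (μ : MeasureTheory.Measure (Literature.MathematicalPhysics.QuantumLattice.FieldConfig (EuclideanSpace ℝ (Fin 3)))) (γ' : EuclideanSpace ℝ (Fin 3) → ℝ → Literature.MathematicalPhysics.QuantumLattice.FieldConfig (EuclideanSpace ℝ (Fin 3)) → MeasureTheory.Measure (Literature.MathematicalPhysics.QuantumLattice.FieldConfig (EuclideanSpace ℝ (Fin 3)))) (P : ℝ → (SchwartzMap (EuclideanSpace ℝ (Fin 3)) ℝ →L[ℝ] SchwartzMap (EuclideanSpace ℝ (Fin 3)) ℝ)), (∀ c r, 0 < r → ∀ η, MeasureTheory.IsProbabilityMeasure (γ' c r η)) → (∀ c r,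 0 < r → ∀ A, MeasurableSet A → Measurable[Literature.MathematicalPhysics.QuantumLattice.extEvents (Metric.closedBall c r)ᶜ] (fun η => γ' c r η A)) → Literature.MathematicalPhysics.QuantumLattice.IsGibbsFor γ' μ Set.univ → (∀ (c : EuclideanSpace ℝ (Fin 3)) (r : ℝ), 0 < r → r < ‖c‖ → ∀ (c' : EuclideanSpace ℝ (Fin 3)) (r' : ℝ), c' = (‖c‖ ^ 2 - r ^ 2)⁻¹ • c → r' = r / (‖c‖ ^ 2 - r ^ 2) → ∀ᵐ η ∂(μ), ∀ (η' : Literature.MathematicalPhysics.QuantumLattice.FieldConfig (EuclideanSpace ℝ (Fin 3))) (ε : ℝ), 0 < ε → (∀ f : SchwartzMap (EuclideanSpace ℝ (Fin 3)) ℝ, HasCompactSupport (f : EuclideanSpace ℝ (Fin 3) → ℝ) → tsupport (f : EuclideanSpace ℝ (Fin 3) → ℝ) ⊆ Metric.ball c' (r' + ε) \ Metric.closedBall c' r' → η' f = η (Literature.Probability.LatticeModels.moebiusWeightedAction Literature.Probability.LatticeModels.ConformalChart.unitInversion Δ f)) → ∀ (m : ℕ) (g : Fin m → SchwartzMap (EuclideanSpace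 ℝ (Fin 3)) ℝ), (∀ k, (HasCompactSupport (g k : EuclideanSpace ℝ (Fin 3) → ℝ) ∧ tsupport (g k : EuclideanSpace ℝ (Fin 3) → ℝ) ⊆ Metric.ball c' r')) → MeasureTheory.Measure.map (fun ω : Literature.MathematicalPhysics.QuantumLattice.FieldConfig (EuclideanSpace ℝ (Fin 3)) => fun k : Fin m => ω (g k)) (γ' c' r' η') = MeasureTheory.Measure.map (fun ω : Literature.MathematicalPhysics.QuantumLattice.FieldConfig (EuclideanSpace ℝ (Fin 3)) => fun k : Fin m => ω (Literature.Probability.LatticeModels.moebiusWeightedAction Literature.Probability.LatticeModels.ConformalChart.unitInversion Δ (g k))) (γ' c r η)) → (∀ s : ℝ, 0 < s → s < 1 → ∀ f : SchwartzMap (EuclideanSpace ℝ (Fin 3)) ℝ, HasCompactSupport (f : EuclideanSpace ℝ (Fin 3) → ℝ) → tsupport (f : EuclideanSpace ℝ (Fin 3) → ℝ) ⊆ {x : EuclideanSpace ℝ (Fin 3) | s < ‖x‖ ∧ ‖x‖ < s⁻¹} → P s f = Literature.Probability.LatticeModels.moebiusWeightedAction Literature.Probability.LatticeModels.ConformalChart.unitInversion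 Δ f) → (∀ s : ℝ, 0 < s → s < 1 → ∀ (f : SchwartzMap (EuclideanSpace ℝ (Fin 3)) ℝ) (x : EuclideanSpace ℝ (Fin 3)), x ∈ tsupport (P s f : EuclideanSpace ℝ (Fin 3) → ℝ) → x ≠ 0 ∧ EuclideanGeometry.inversion 0 1 x ∈ tsupport (f : EuclideanSpace ℝ (Fin 3) → ℝ)) → ∀ s : ℝ, 0 < s → s < 1 → ∀ (c : EuclideanSpace ℝ (Fin 3)) (r : ℝ), 0 < r → Metric.closedBall c r ⊆ {x : EuclideanSpace ℝ (Fin 3) | s < ‖x‖ ∧ ‖x‖ < s⁻¹} → ∀ A, MeasurableSet[Literature.MathematicalPhysics.QuantumLattice.extEvents (Metric.ball c r)] A → ∀ B, MeasurableSet[Literature.MathematicalPhysics.QuantumLattice.extEvents (Metric.closedBall c r)ᶜ] B → (MeasureTheory.Measure.map (Literature.MathematicalPhysics.QuantumLattice.FieldConfig.act (P s)) μ) (A ∩ B) = ∫⁻ η in B, γ' c r η A ∂(MeasureTheory.Measure.map (Literature.MathematicalPhysics.QuantumLattice.FieldConfig.act (P s)) μ) := by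
  intro Δ μ γ' P k1 k2 hG hCB hP3 hP2 s hs hs1 c r hr hsub A hA B hB
  have hRo : IsOpen {x : EuclideanSpace ℝ (Fin 3) | s < ‖x‖ ∧ ‖x‖ < s⁻¹} :=
    (isOpen_lt continuous_const continuous_norm).and (isOpen_lt continuous_norm continuous_const)
  have hR0 : (0 : EuclideanSpace ℝ (Fin 3)) ∉ {x : EuclideanSpace ℝ (Fin 3) | s < ‖x‖ ∧ ‖x‖ < s⁻¹} :=
    fun h => lt_irrefl (0 : ℝ) (hs.trans (by simpa only [mem_setOf_eq, norm_zero] using h.1))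
  exact transportDLR_main Δ hRo hR0 k1 k2 hG hCB (hP3 s hs hs1) (hP2 s hs hs1) hr hsub hA hB

end Summit.CriticalPhenomena.Ising3DConformalLimit.BallSpecificationBallSpecifiedInversionUpgrade

end
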